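import Summits.CriticalPhenomena.PercolationContinuityZ3.Theorems.PercNearOneGluingNoHeavyLowerTailSahiE3TwoLayerBernstein
import Mathlib.Tactic.Linarith
import Mathlib.Tactic.Ring
import Mathlib.Tactic.Positivity
import HarnessLib
import HarnessLib.Audit

/-!
# `NoHeavyLowerTail` (crux stmt-CriticalPhenomena-4575), Sahi programme P4: the OR-peel of the mixed coefficient `Z*` (Bernstein form in the peeled variable)

Support file (cell `prim-l12`, seat P4, generation 20; `--supports stmt-CriticalPhenomena-4575`).  No named facts, no sorries;
standard axioms; def-free.

Context (HOME prim-l12-p4/FROM-prim-l12-p4-gen20-OR-PEEL.md).  `…SahiE3TwoLayerBernstein.pair_two_layer` reduces the pair inequality of the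
AND-gluing composite `flat₁(V, y ∧ G'')` (hence the flagship `(x₀∧(x₁∨x₂)) ∨ (y₀∧(y₁∨y₂))`) to the nonnegativity of a MIXED COEFFICIENT
  `Z = R0(S₁∩S₁') + Φ(S₀∩S₀') + v(s₁s₀'+s₀s₁') + v̄g''(s₀s₀' − (s₁−s₀)(s₁'−s₀')) − s₁·a(S₀') − s₁'·a(S₀) − s₀·u(S₁') − s₀'·u(S₁)`
on `M = Q'' × …`.  When `G'' = z ∨ G'` is OR-rooted (`Q'' = Bool_z × M'`, `P(z) = p`, `g'' = p + (1−p)g'`), the top layer of the slot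
`U₁ = V ∨ G''` is everything and its bottom layer is `U' = V ∨ G'`, the slot `A = V × Q''` is a cylinder over `A'`, and the two data
`R0, Φ` of the composite are ROOT-QUADRATIC in `p` layer by layer:
  `R0(true,m) = p²T₂ m + p(1−p)T₁ m`, `R0(false,m) = p(1−p)B₁ m + (1−p)²B₀ m`,  `Φ(true,m) = p²F₂ m + p(1−p)F₁ m`,
  `Φ(false,m) = p(1−p)G₁ m + (1−p)²G₀ m`
(for the natural certificate of `z ∨ G'`: `T₂ = (a+v̄m)`, `T₁ = T₂ + ḡ'c − c_{Ḡ'}`, `B₁ = (1+v̄)a_G + r_{Ḡ'} + v̄c_G`, `B₀ = R0_{V,G'}`,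
`F₂ = a`, `F₁ = ḡ'r + g'a`, `G₁ = a`, `G₀ = Φ_{V,G'}` — memo §1; not needed for the identity).
THEOREM `zstar_or_peel` (pure algebra): for ANY sets `S₁, S₀, S₁', S₀'` of `Bool × M'` with layers `(P,K), (L,O), (P',K'), (L',O')`,
  `Z = p³·C₃ + p²(1−p)·C₂ + p(1−p)²·C₁ + (1−p)³·C₀`
with the four coefficients displayed in the statement; `C₃` is the `Z` of the pair `(V, TRUE)` at the true layers and `C₀` the `Z` of
`(V, G')` at the false layers (memo F1), so by `zstar_nonneg_of_orPeel` the induction over clauses `z₁ ∨ ⋯ ∨ z_m` only needs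
`C₂ − C₃ ≥ 0` and `C₁ − C₀ ≥ 0` (the "2×2 exchange" inequalities D₂, D₁ of the memo; their crossing-free case is
`…SahiE3ExchangeCross`).  Numerically D₁, D₂ ≥ 0 in every exact test (memo F3); the general case is open.
-/

namespace Summit.CriticalPhenomena.PercolationContinuityZ3.Theorems.SahiE3ZstarOrPeel

open Finset SahiE3LroLayers SahiE3LroOrStep SahiE3TwoLayerBernstein
open scoped BigOperators

variable {M : Type*} [Fintype M] [DecidableEq M]

/-- **The OR-peel of the mixed coefficient** (see the module docstring): `Z = p³C₃ + p²qC₂ + pq²C₁ + q³C₀`, `q = 1 − p`,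
as a formal identity for root-quadratic layer data `R0 = (T₂,T₁ | B₁,B₀)`, `Φ = (F₂,F₁ | G₁,G₀)`, slot layers `(univ | U')` and
`(A' | A')`, and arbitrary scalars `v, v̄, g'`. [this work] -/
theorem zstar_or_peel (μ : M → ℝ) (U' A' : Finset M) (T₂ T₁ B₁ B₀ F₂ F₁ G₁ G₀ : M → ℝ) (p v vb g' : ℝ)
    (ν : Bool × M → ℝ) (hνt : ∀ m, ν (true, m) = p * μ m) (hνf : ∀ m, ν (false, m) = (1 - p) * μ m)
    (R0 Φ : Bool × M → ℝ)
    (hRt : ∀ m, R0 (true, m) = p ^ 2 * T₂ m + p * (1 - p) * T₁ m)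
    (hRf : ∀ m, R0 (false, m) = p * (1 - p) * B₁ m + (1 - p) ^ 2 * B₀ m)
    (hΦt : ∀ m, Φ (true, m) = p ^ 2 * F₂ m + p * (1 - p) * F₁ m)
    (hΦf : ∀ m, Φ (false, m) = p * (1 - p) * G₁ m + (1 - p) ^ 2 * G₀ m)
    (U₁ : Finset (Bool × M)) (hU₁ : ∀ x, x ∈ U₁ ↔ ((x.1 = true ∧ x.2 ∈ (univ : Finset M)) ∨ (x.1 = false ∧ x.2 ∈ U')))
    (A : Finset (Bool × M)) (hA : ∀ x, x ∈ A ↔ ((x.1 = true ∧ x.2 ∈ A') ∨ (x.1 = false ∧ x.2 ∈ A')))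
    (S₁ S₀ S₁' S₀' : Finset (Bool × M)) (P K L O P' K' L' O' : Finset M)
    (hP : P = univ.filter (fun m => (true, m) ∈ S₁)) (hK : K = univ.filter (fun m => (false, m) ∈ S₁))
    (hL : L = univ.filter (fun m => (true, m) ∈ S₀)) (hO : O = univ.filter (fun m => (false, m) ∈ S₀))
    (hP' : P' = univ.filter (fun m => (true, m) ∈ S₁')) (hK' : K' = univ.filter (fun m => (false, m) ∈ S₁'))
    (hL' : L' = univ.filter (fun m => (true, m) ∈ S₀')) (hO' : O' = univ.filter (fun m => (false, m) ∈ S₀')) :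
    (∑ x ∈ S₁ ∩ S₁', R0 x) + (∑ x ∈ S₀ ∩ S₀', Φ x)
      + v * ((∑ x ∈ S₁, ν x) * (∑ x ∈ S₀', ν x) + (∑ x ∈ S₀, ν x) * (∑ x ∈ S₁', ν x))
      + vb * (p + (1 - p) * g') * ((∑ x ∈ S₀, ν x) * (∑ x ∈ S₀', ν x)
          - ((∑ x ∈ S₁, ν x) - ∑ x ∈ S₀, ν x) * ((∑ x ∈ S₁', ν x) - ∑ x ∈ S₀', ν x))
      - (∑ x ∈ S₁, ν x) * (∑ x ∈ S₀' ∩ A, ν x) - (∑ x ∈ S₁', ν x) * (∑ x ∈ S₀ ∩ A, ν x)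
      - (∑ x ∈ S₀, ν x) * (∑ x ∈ S₁' ∩ U₁, ν x) - (∑ x ∈ S₀', ν x) * (∑ x ∈ S₁ ∩ U₁, ν x)
    = p ^ 3 * ((∑ m ∈ P ∩ P', T₂ m) + (∑ m ∈ L ∩ L', F₂ m)
          + v * ((∑ m ∈ P, μ m) * (∑ m ∈ L', μ m) + (∑ m ∈ L, μ m) * (∑ m ∈ P', μ m))
          + vb * ((∑ m ∈ L, μ m) * (∑ m ∈ L', μ m) - ((∑ m ∈ P, μ m) - ∑ m ∈ L, μ m) * ((∑ m ∈ P', μ m) - ∑ m ∈ L', μ m))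
          - (∑ m ∈ P, μ m) * (∑ m ∈ L' ∩ A', μ m) - (∑ m ∈ P', μ m) * (∑ m ∈ L ∩ A', μ m)
          - (∑ m ∈ L, μ m) * (∑ m ∈ P', μ m) - (∑ m ∈ L', μ m) * (∑ m ∈ P, μ m))
      + p ^ 2 * (1 - p) * ((∑ m ∈ P ∩ P', T₂ m) + (∑ m ∈ P ∩ P', T₁ m) + (∑ m ∈ K ∩ K', B₁ m)
          + (∑ m ∈ L ∩ L', F₂ m) + (∑ m ∈ L ∩ L', F₁ m) + (∑ m ∈ O ∩ O', G₁ m)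
          + v * ((∑ m ∈ P, μ m) * (∑ m ∈ L', μ m) + (∑ m ∈ P, μ m) * (∑ m ∈ O', μ m) + (∑ m ∈ K, μ m) * (∑ m ∈ L', μ m)
              + (∑ m ∈ L, μ m) * (∑ m ∈ P', μ m) + (∑ m ∈ O, μ m) * (∑ m ∈ P', μ m) + (∑ m ∈ L, μ m) * (∑ m ∈ K', μ m))
          + vb * g' * ((∑ m ∈ L, μ m) * (∑ m ∈ L', μ m) - ((∑ m ∈ P, μ m) - ∑ m ∈ L, μ m) * ((∑ m ∈ P', μ m) - ∑ m ∈ L', μ m))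
          + vb * ((∑ m ∈ L, μ m) * (∑ m ∈ O', μ m) + (∑ m ∈ O, μ m) * (∑ m ∈ L', μ m)
              - ((∑ m ∈ P, μ m) - ∑ m ∈ L, μ m) * ((∑ m ∈ K', μ m) - ∑ m ∈ O', μ m)
              - ((∑ m ∈ K, μ m) - ∑ m ∈ O, μ m) * ((∑ m ∈ P', μ m) - ∑ m ∈ L', μ m))
          - ((∑ m ∈ P, μ m) * (∑ m ∈ L' ∩ A', μ m) + (∑ m ∈ P, μ m) * (∑ m ∈ O' ∩ A', μ m) + (∑ m ∈ K, μ m) * (∑ m ∈ L' ∩ A', μ m)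
              + (∑ m ∈ P', μ m) * (∑ m ∈ L ∩ A', μ m) + (∑ m ∈ P', μ m) * (∑ m ∈ O ∩ A', μ m) + (∑ m ∈ K', μ m) * (∑ m ∈ L ∩ A', μ m))
          - ((∑ m ∈ L, μ m) * (∑ m ∈ P', μ m) + (∑ m ∈ L, μ m) * (∑ m ∈ K' ∩ U', μ m) + (∑ m ∈ O, μ m) * (∑ m ∈ P', μ m)
              + (∑ m ∈ L', μ m) * (∑ m ∈ P, μ m) + (∑ m ∈ L', μ m) * (∑ m ∈ K ∩ U', μ m) + (∑ m ∈ O', μ m) * (∑ m ∈ P, μ m)))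
      + p * (1 - p) ^ 2 * ((∑ m ∈ P ∩ P', T₁ m) + (∑ m ∈ K ∩ K', B₁ m) + (∑ m ∈ K ∩ K', B₀ m)
          + (∑ m ∈ L ∩ L', F₁ m) + (∑ m ∈ O ∩ O', G₁ m) + (∑ m ∈ O ∩ O', G₀ m)
          + v * ((∑ m ∈ P, μ m) * (∑ m ∈ O', μ m) + (∑ m ∈ K, μ m) * (∑ m ∈ L', μ m) + (∑ m ∈ K, μ m) * (∑ m ∈ O', μ m)
              + (∑ m ∈ O, μ m) * (∑ m ∈ P', μ m) + (∑ m ∈ L, μ m) * (∑ m ∈ K', μ m) + (∑ m ∈ O, μ m) * (∑ m ∈ K', μ m))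
          + vb * g' * ((∑ m ∈ L, μ m) * (∑ m ∈ O', μ m) + (∑ m ∈ O, μ m) * (∑ m ∈ L', μ m)
              - ((∑ m ∈ P, μ m) - ∑ m ∈ L, μ m) * ((∑ m ∈ K', μ m) - ∑ m ∈ O', μ m)
              - ((∑ m ∈ K, μ m) - ∑ m ∈ O, μ m) * ((∑ m ∈ P', μ m) - ∑ m ∈ L', μ m))
          + vb * ((∑ m ∈ O, μ m) * (∑ m ∈ O', μ m) - ((∑ m ∈ K, μ m) - ∑ m ∈ O, μ m) * ((∑ m ∈ K', μ m) - ∑ m ∈ O', μ m))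
          - ((∑ m ∈ P, μ m) * (∑ m ∈ O' ∩ A', μ m) + (∑ m ∈ K, μ m) * (∑ m ∈ L' ∩ A', μ m) + (∑ m ∈ K, μ m) * (∑ m ∈ O' ∩ A', μ m)
              + (∑ m ∈ P', μ m) * (∑ m ∈ O ∩ A', μ m) + (∑ m ∈ K', μ m) * (∑ m ∈ L ∩ A', μ m) + (∑ m ∈ K', μ m) * (∑ m ∈ O ∩ A', μ m))
          - ((∑ m ∈ L, μ m) * (∑ m ∈ K' ∩ U', μ m) + (∑ m ∈ O, μ m) * (∑ m ∈ P', μ m) + (∑ m ∈ O, μ m) * (∑ m ∈ K' ∩ U', μ m)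
              + (∑ m ∈ L', μ m) * (∑ m ∈ K ∩ U', μ m) + (∑ m ∈ O', μ m) * (∑ m ∈ P, μ m) + (∑ m ∈ O', μ m) * (∑ m ∈ K ∩ U', μ m)))
      + (1 - p) ^ 3 * ((∑ m ∈ K ∩ K', B₀ m) + (∑ m ∈ O ∩ O', G₀ m)
          + v * ((∑ m ∈ K, μ m) * (∑ m ∈ O', μ m) + (∑ m ∈ O, μ m) * (∑ m ∈ K', μ m))
          + vb * g' * ((∑ m ∈ O, μ m) * (∑ m ∈ O', μ m) - ((∑ m ∈ K, μ m) - ∑ m ∈ O, μ m) * ((∑ m ∈ K', μ m) - ∑ m ∈ O', μ m))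
          - (∑ m ∈ K, μ m) * (∑ m ∈ O' ∩ A', μ m) - (∑ m ∈ K', μ m) * (∑ m ∈ O ∩ A', μ m)
          - (∑ m ∈ O, μ m) * (∑ m ∈ K' ∩ U', μ m) - (∑ m ∈ O', μ m) * (∑ m ∈ K ∩ U', μ m)) := by
  -- layer decompositions of all the sums over `Bool × M`
  have lay : ∀ X : Finset (Bool × M), ∑ x ∈ X, ν x =
      p * ∑ t ∈ univ.filter (fun t => (true, t) ∈ X), μ t
        + (1 - p) * ∑ t ∈ univ.filter (fun t => (false, t) ∈ X), μ t := by
    intro X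
    rw [sum_layers, Finset.mul_sum, Finset.mul_sum]
    exact congrArg₂ (· + ·) (Finset.sum_congr rfl fun t _ => hνt t) (Finset.sum_congr rfl fun t _ => hνf t)
  have layR : ∑ x ∈ S₁ ∩ S₁', R0 x =
      (∑ t ∈ univ.filter (fun t => (true, t) ∈ S₁ ∩ S₁'), (p ^ 2 * T₂ t + p * (1 - p) * T₁ t))
        + ∑ t ∈ univ.filter (fun t => (false, t) ∈ S₁ ∩ S₁'), (p * (1 - p) * B₁ t + (1 - p) ^ 2 * B₀ t) := by
    rw [sum_layers]
    exact congrArg₂ (· + ·) (Finset.sum_congr rfl fun t _ => hRt t) (Finset.sum_congr rfl fun t _ => hRf t)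
  have layΦ : ∑ x ∈ S₀ ∩ S₀', Φ x =
      (∑ t ∈ univ.filter (fun t => (true, t) ∈ S₀ ∩ S₀'), (p ^ 2 * F₂ t + p * (1 - p) * F₁ t))
        + ∑ t ∈ univ.filter (fun t => (false, t) ∈ S₀ ∩ S₀'), (p * (1 - p) * G₁ t + (1 - p) ^ 2 * G₀ t) := by
    rw [sum_layers]
    exact congrArg₂ (· + ·) (Finset.sum_congr rfl fun t _ => hΦt t) (Finset.sum_congr rfl fun t _ => hΦf t)
  have hW₁t : univ.filter (fun t => (true, t) ∈ S₁ ∩ S₁') = P ∩ P' := by rw [layers_inter, hP, hP']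
  have hW₁f : univ.filter (fun t => (false, t) ∈ S₁ ∩ S₁') = K ∩ K' := by rw [layers_inter, hK, hK']
  have hW₀t : univ.filter (fun t => (true, t) ∈ S₀ ∩ S₀') = L ∩ L' := by rw [layers_inter, hL, hL']
  have hW₀f : univ.filter (fun t => (false, t) ∈ S₀ ∩ S₀') = O ∩ O' := by rw [layers_inter, hO, hO']
  obtain ⟨LS1U1, LS1U0, -, -⟩ := layers_twoSlot univ U' U₁ hU₁ S₁
  obtain ⟨LS1U1', LS1U0', -, -⟩ := layers_twoSlot univ U' U₁ hU₁ S₁'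
  obtain ⟨LS0A1, LS0A0, -, -⟩ := layers_twoSlot A' A' A hA S₀
  obtain ⟨LS0A1', LS0A0', -, -⟩ := layers_twoSlot A' A' A hA S₀'
  have eS₁ : ∑ x ∈ S₁, ν x = p * (∑ m ∈ P, μ m) + (1 - p) * ∑ m ∈ K, μ m := by rw [lay S₁, ← hP, ← hK]
  have eS₀ : ∑ x ∈ S₀, ν x = p * (∑ m ∈ L, μ m) + (1 - p) * ∑ m ∈ O, μ m := by rw [lay S₀, ← hL, ← hO]
  have eS₁' : ∑ x ∈ S₁', ν x = p * (∑ m ∈ P', μ m) + (1 - p) * ∑ m ∈ K', μ m := by rw [lay S₁', ← hP', ← hK']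
  have eS₀' : ∑ x ∈ S₀', ν x = p * (∑ m ∈ L', μ m) + (1 - p) * ∑ m ∈ O', μ m := by rw [lay S₀', ← hL', ← hO']
  have eS₁U : ∑ x ∈ S₁ ∩ U₁, ν x = p * (∑ m ∈ P, μ m) + (1 - p) * ∑ m ∈ K ∩ U', μ m := by
    rw [lay (S₁ ∩ U₁), LS1U1, LS1U0, ← hP, ← hK, Finset.inter_univ]
  have eS₁'U : ∑ x ∈ S₁' ∩ U₁, ν x = p * (∑ m ∈ P', μ m) + (1 - p) * ∑ m ∈ K' ∩ U', μ m := by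
    rw [lay (S₁' ∩ U₁), LS1U1', LS1U0', ← hP', ← hK', Finset.inter_univ]
  have eS₀A : ∑ x ∈ S₀ ∩ A, ν x = p * (∑ m ∈ L ∩ A', μ m) + (1 - p) * ∑ m ∈ O ∩ A', μ m := by
    rw [lay (S₀ ∩ A), LS0A1, LS0A0, ← hL, ← hO]
  have eS₀'A : ∑ x ∈ S₀' ∩ A, ν x = p * (∑ m ∈ L' ∩ A', μ m) + (1 - p) * ∑ m ∈ O' ∩ A', μ m := by
    rw [lay (S₀' ∩ A), LS0A1', LS0A0', ← hL', ← hO']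
  have eR : ∑ x ∈ S₁ ∩ S₁', R0 x = p ^ 2 * (∑ m ∈ P ∩ P', T₂ m) + p * (1 - p) * (∑ m ∈ P ∩ P', T₁ m)
      + (p * (1 - p) * (∑ m ∈ K ∩ K', B₁ m) + (1 - p) ^ 2 * ∑ m ∈ K ∩ K', B₀ m) := by
    rw [layR, hW₁t, hW₁f, Finset.sum_add_distrib, Finset.sum_add_distrib, ← Finset.mul_sum, ← Finset.mul_sum,
      ← Finset.mul_sum, ← Finset.mul_sum]
  have eΦ : ∑ x ∈ S₀ ∩ S₀', Φ x = p ^ 2 * (∑ m ∈ L ∩ L', F₂ m) + p * (1 - p) * (∑ m ∈ L ∩ L', F₁ m)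
      + (p * (1 - p) * (∑ m ∈ O ∩ O', G₁ m) + (1 - p) ^ 2 * ∑ m ∈ O ∩ O', G₀ m) := by
    rw [layΦ, hW₀t, hW₀f, Finset.sum_add_distrib, Finset.sum_add_distrib, ← Finset.mul_sum, ← Finset.mul_sum,
      ← Finset.mul_sum, ← Finset.mul_sum]
  rw [eR, eΦ, eS₁, eS₀, eS₁', eS₀', eS₁U, eS₁'U, eS₀A, eS₀'A]
  ring

/-- **Peel reduction.**  If `0 ≤ p ≤ 1` and the four Bernstein coefficients are nonnegative, the mixed coefficient is nonnegative;
stated for the coefficient DIFFERENCES used by the clause induction (`C₃ ≥ 0`, `C₂ − C₃ ≥ 0`, `C₁ − C₀ ≥ 0`, `C₀ ≥ 0`). [this work] -/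
theorem cubic_nonneg_of_bernstein_diffs {p C₃ C₂ C₁ C₀ : ℝ} (hp0 : 0 ≤ p) (hp1 : p ≤ 1)
    (h3 : 0 ≤ C₃) (h2 : 0 ≤ C₂ - C₃) (h1 : 0 ≤ C₁ - C₀) (h0 : 0 ≤ C₀) :
    0 ≤ p ^ 3 * C₃ + p ^ 2 * (1 - p) * C₂ + p * (1 - p) ^ 2 * C₁ + (1 - p) ^ 3 * C₀ := by
  have hq : 0 ≤ 1 - p := by linarith
  have a3 : 0 ≤ p ^ 3 * C₃ := mul_nonneg (pow_nonneg hp0 3) h3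
  have a2 : 0 ≤ p ^ 2 * (1 - p) * C₂ := mul_nonneg (mul_nonneg (pow_nonneg hp0 2) hq) (by linarith)
  have a1 : 0 ≤ p * (1 - p) ^ 2 * C₁ := mul_nonneg (mul_nonneg hp0 (pow_nonneg hq 2)) (by linarith)
  have a0 : 0 ≤ (1 - p) ^ 3 * C₀ := mul_nonneg (pow_nonneg hq 3) h0
  linarith

end Summit.CriticalPhenomena.PercolationContinuityZ3.Theorems.SahiE3ZstarOrPeel
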